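import Summits.AtomisticToContinuum.BoseEinsteinCondensation.Theorems.BECThomsonPrincipleFibreConductanceCageDefs
import Summits.AtomisticToContinuum.BoseEinsteinCondensation.Theorems.BECThomsonPrincipleFibreConductanceStubBetaCorrector
import HarnessLib

/-!
# Route `BECThomsonPrinciple`, crux `FibreConductance` (stmt-AtomisticToContinuum-9480),
# line `tagged-path-harnack-cage-moments` — stub `stub_betaHolder`: the β-CHANNEL BY HÖLDER

`stub_betaHolder : DensityFlatteningCubic → ShellOccupation → BetaCorrectorBound`.

The β-channel of the transport defect, `ε♮ = L^{-3/2} β (ψ² − L⁻³)` (`densDefect`), is corrected by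
`J♮ := L^{-3/2} β · J_d`, where `J_d` is the flow of `DensityFlatteningCubic` (weak divergence
`ψ² − L⁻³`, bath-averaged CUBED fibre cost `∫ W·D³ ≤ K_d L⁹`, `D = fibreDensCost Φ J_d` — the
k-blind Poincaré scale `D = O(L²)`). This is the landed Cauchy–Schwarz β-corrector
(`BECThomsonPrincipleFibreConductanceStubBetaCorrector`, `stub_betaCorrector`) with Cauchy–Schwarz
in the bath replaced by HÖLDER `(3/2, 3)`:

* `J♮` has weak divergence `ε♮` (`bc_hasWeakDiv_beta_mul`: `β` is `C¹`, bath-periodic and constant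
  along the `x₀`-fibre);
* its cost is the bath average `L⁻³ ∫ (|β|²/L³)·W·D` (`bh_fibreCost_eq`), and by Hölder with the
  bounded weight `b = |β|²/L³ ∈ [0, 1]` (`norm_sq_fibreBeta_le`, so `b^{3/2} ≤ b`),
  `∫ b·W·D ≤ (∫ b·W)^{2/3} (∫ W·D³)^{1/3}` (`bh_lintegral_mul_le`,
  `ENNReal.lintegral_mul_le_Lp_mul_Lq`);
* `∫ b·W = L³ · n_{−n}(|Φ|)/N ≤ L³K/(‖n‖²p₁)` is an occupation
  (`lintegral_fibreW_mul_norm_sq_cellFourierCoeff`), bounded by `ShellOccupation` at the resonant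
  mode `p = −n` with the admissible radius `p₁ = min(θ√ρ L/2π, ‖n‖/2)` (`bh_lintegral_beta_weight_le`);
* the resulting `K^{2/3}K_d^{1/3} L²/(‖n‖^{4/3}p₁^{2/3})` is `≤ C L²/‖n‖²` iff `K²K_d‖n‖² ≤ C³p₁²`
  (`bh_real_bound`, comparing cubes), which holds in both cases of the `min` with
  `C = 4K²K_d + K²K_dM²/θ² + 1` because `‖n‖ ≤ M√ρ L/2π` in the window (`bh_key`) — no threshold
  on `L` is needed.

References: the line card `Cruxes/FibreConductance/Lines/tagged-path-harnack-cage-moments.md`;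
LSSY2005 §1.2 (1.17) (occupations) — used only as the meaning of `cellOccupation`; R. Lyons,
Y. Peres, *Probability on Trees and Networks* (2016) Ch. 2 (any admissible flow bounds the
resistance).
-/

noncomputable section

namespace Summit.AtomisticToContinuum.BoseEinsteinCondensation.Cruxes.FibreConductance.TaggedPathHarnack

open MeasureTheory
open scoped ENNReal
open Literature.MathematicalPhysics.QuantumManyBody.BoseGas
open Summit.AtomisticToContinuum.BoseEinsteinCondensation.Cruxes.FibreConductance.ParsevalShellBootstrap
open Summit.AtomisticToContinuum.BoseEinsteinCondensation.Theorems.GaussianDominationCan.Negative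
  (one_le_norm_intVec)

variable {m : ℕ} {L : ℝ}

/-! ### The cost of `J♮ = L^{-3/2} β J` as a bath average -/

/-- The fibre density `Σ_l |J_l|²/ψ²` of a measurable flow is measurable. [folklore] -/
private theorem bh_measurable_ratio (hL : 0 < L) (Φ : PeriodicTrialState (m + 1) L)
    (hΦ : ∀ X, Φ.ψ X ≠ 0) {J : Config (m + 1) → Fin 3 → ℂ} (hJm : Measurable J) :
    Measurable fun X : Config (m + 1) =>
      ENNReal.ofReal ((∑ l : Fin 3, ‖J X l‖ ^ 2) / fibrePsi Φ X ^ 2) :=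
  ((Finset.measurable_sum _ fun l _ => ((measurable_pi_apply l).comp hJm).norm.pow_const 2).div
    ((measurable_fibrePsi hL Φ hΦ).pow_const 2)).ennreal_ofReal

/-- The fibre cost `D(X̂) = ∫_cell Σ_l|J_l|²/ψ² dy` of a measurable flow is measurable in the
configuration (Tonelli measurability of a partial integral). [folklore] -/
private theorem bh_measurable_fibreDensCost (hL : 0 < L) (Φ : PeriodicTrialState (m + 1) L)
    (hΦ : ∀ X, Φ.ψ X ≠ 0) {J : Config (m + 1) → Fin 3 → ℂ} (hJm : Measurable J) :
    Measurable (fibreDensCost Φ J) := by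
  have hF : Measurable fun q : Config (m + 1) × Space =>
      ENNReal.ofReal ((∑ l : Fin 3, ‖J (Function.update q.1 0 q.2) l‖ ^ 2) /
        fibrePsi Φ (Function.update q.1 0 q.2) ^ 2) :=
    (bh_measurable_ratio hL Φ hΦ hJm).comp (measurable_update' (a := (0 : Fin (m + 1))))
  exact hF.lintegral_prod_right'

/-- **The cost of `J♮` is a bath average**: pointwise
`Σ_l |L^{-3/2} β J_l|² W/ψ² = (|β|²/L³)·W·(Σ_l |J_l|²/ψ²)`, and `β`, `W` are constant along the
fibre, so `∫|J♮|²W/ψ² = L⁻³ ∫_{cell^N} (|β|²/L³)·W·D` (`lintegral_cellN_eq_fibre_average`).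
[folklore] -/
private theorem bh_fibreCost_eq (hL : 0 < L) (n : Fin 3 → ℤ) (Φ : PeriodicTrialState (m + 1) L)
    (hΦ : ∀ X, Φ.ψ X ≠ 0) {J : Config (m + 1) → Fin 3 → ℂ} (hJm : Measurable J) :
    fibreCost Φ (fun X l => ((Real.sqrt (L ^ 3))⁻¹ : ℂ) * fibreBeta n Φ X * J X l) =
      (ENNReal.ofReal (L ^ 3))⁻¹ * ∫⁻ X in cellN (m + 1) L,
        ENNReal.ofReal ((L ^ 3)⁻¹ * ‖fibreBeta n Φ X‖ ^ 2 * fibreW Φ X) * fibreDensCost Φ J X := by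
  have hL3 : 0 < L ^ 3 := by positivity
  have hbm : Measurable fun X : Config (m + 1) =>
      (L ^ 3)⁻¹ * ‖fibreBeta n Φ X‖ ^ 2 * fibreW Φ X :=
    (measurable_const.mul ((measurable_fibreBeta hL n Φ hΦ).norm.pow_const 2)).mul
      (measurable_fibreW Φ)
  -- pointwise cost density
  have hpt : ∀ X : Config (m + 1), ENNReal.ofReal
      ((∑ l : Fin 3, ‖((Real.sqrt (L ^ 3))⁻¹ : ℂ) * fibreBeta n Φ X * J X l‖ ^ 2) * fibreW Φ X /
        fibrePsi Φ X ^ 2) =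
      ENNReal.ofReal ((L ^ 3)⁻¹ * ‖fibreBeta n Φ X‖ ^ 2 * fibreW Φ X) *
        ENNReal.ofReal ((∑ l : Fin 3, ‖J X l‖ ^ 2) / fibrePsi Φ X ^ 2) := by
    intro X
    have hl : ∀ l : Fin 3, ‖((Real.sqrt (L ^ 3))⁻¹ : ℂ) * fibreBeta n Φ X * J X l‖ ^ 2 =
        (L ^ 3)⁻¹ * ‖fibreBeta n Φ X‖ ^ 2 * ‖J X l‖ ^ 2 := by
      intro l
      rw [norm_mul, norm_mul, norm_inv, Complex.norm_real,
        Real.norm_of_nonneg (Real.sqrt_nonneg _), mul_pow, mul_pow, inv_pow, Real.sq_sqrt hL3.le]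
    rw [← ENNReal.ofReal_mul (mul_nonneg (by positivity) (fibreW_nonneg Φ X))]
    congr 1
    simp_rw [hl]
    rw [← Finset.mul_sum]
    ring
  unfold fibreCost
  simp_rw [hpt]
  have hG : Measurable fun X : Config (m + 1) =>
      ENNReal.ofReal ((L ^ 3)⁻¹ * ‖fibreBeta n Φ X‖ ^ 2 * fibreW Φ X) *
        ENNReal.ofReal ((∑ l : Fin 3, ‖J X l‖ ^ 2) / fibrePsi Φ X ^ 2) :=
    hbm.ennreal_ofReal.mul (bh_measurable_ratio hL Φ hΦ hJm)
  rw [lintegral_cellN_eq_fibre_average hL hG]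
  congr 1
  refine setLIntegral_congr_fun (measurableSet_cellN (m + 1) L) fun X _ => ?_
  simp only [fibreBeta_update, fibreW_update]
  rw [lintegral_const_mul' _ _ ENNReal.ofReal_ne_top]
  rfl

/-! ### Hölder `(3/2, 3)` in the bath; the bath expectation of `|β|²/L³` is an occupation -/

/-- **Hölder `(3/2, 3)` with a bounded weight**: for `0 ≤ b ≤ 1`, `w ≥ 0` and measurable
`D ≥ 0`, `∫ b·w·D ≤ (∫ b·w)^{2/3} (∫ w·D³)^{1/3}` (split `b w D = (b w^{2/3})·(w^{1/3} D)` and use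
`b^{3/2} ≤ b`). [folklore] -/
private theorem bh_lintegral_mul_le {α : Type*} [MeasurableSpace α] (μ : Measure α)
    {b w : α → ℝ} {D : α → ℝ≥0∞} (hb : Measurable b) (hw : Measurable w) (hD : Measurable D)
    (hb0 : ∀ x, 0 ≤ b x) (hb1 : ∀ x, b x ≤ 1) :
    ∫⁻ x, ENNReal.ofReal (b x * w x) * D x ∂μ ≤
      (∫⁻ x, ENNReal.ofReal (b x * w x) ∂μ) ^ (2 / 3 : ℝ) *
        (∫⁻ x, ENNReal.ofReal (w x) * D x ^ 3 ∂μ) ^ (1 / 3 : ℝ) := by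
  set f : α → ℝ≥0∞ := fun x => ENNReal.ofReal (b x) * ENNReal.ofReal (w x) ^ (2 / 3 : ℝ) with hf
  set g : α → ℝ≥0∞ := fun x => ENNReal.ofReal (w x) ^ (1 / 3 : ℝ) * D x with hg
  have hfg : ∀ x, ENNReal.ofReal (b x * w x) * D x = (f * g) x := by
    intro x
    have hw1 : ENNReal.ofReal (w x) ^ (2 / 3 : ℝ) * ENNReal.ofReal (w x) ^ (1 / 3 : ℝ) =
        ENNReal.ofReal (w x) := by
      rw [← ENNReal.rpow_add_of_nonneg _ _ (by norm_num) (by norm_num),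
        show (2 / 3 : ℝ) + 1 / 3 = 1 by norm_num, ENNReal.rpow_one]
    rw [ENNReal.ofReal_mul (hb0 x), ← hw1]
    simp only [Pi.mul_apply, hf, hg]
    ring
  have hf2 : ∀ x, f x ^ (3 / 2 : ℝ) ≤ ENNReal.ofReal (b x * w x) := by
    intro x
    rw [hf, ENNReal.mul_rpow_of_nonneg _ _ (by norm_num), ← ENNReal.rpow_mul,
      show (2 / 3 : ℝ) * (3 / 2) = 1 by norm_num, ENNReal.rpow_one, ENNReal.ofReal_mul (hb0 x)]
    exact mul_le_mul' (ENNReal.rpow_le_self_of_le_one (ENNReal.ofReal_le_one.2 (hb1 x))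
      (by norm_num)) le_rfl
  have hg3 : ∀ x, g x ^ (3 : ℝ) = ENNReal.ofReal (w x) * D x ^ 3 := by
    intro x
    rw [hg, ENNReal.mul_rpow_of_nonneg _ _ (by norm_num), ← ENNReal.rpow_mul,
      show (1 / 3 : ℝ) * 3 = 1 by norm_num, ENNReal.rpow_one, ENNReal.rpow_ofNat]
  have hwm : Measurable fun x => ENNReal.ofReal (w x) := hw.ennreal_ofReal
  have hfm : AEMeasurable f μ := (hb.ennreal_ofReal.mul (hwm.pow_const _)).aemeasurable
  have hgm : AEMeasurable g μ := ((hwm.pow_const _).mul hD).aemeasurable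
  have hpq : (3 / 2 : ℝ).HolderConjugate 3 :=
    Real.holderConjugate_iff.2 ⟨by norm_num, by norm_num⟩
  calc ∫⁻ x, ENNReal.ofReal (b x * w x) * D x ∂μ = ∫⁻ x, (f * g) x ∂μ := lintegral_congr hfg
    _ ≤ (∫⁻ x, f x ^ (3 / 2 : ℝ) ∂μ) ^ (1 / (3 / 2 : ℝ)) *
          (∫⁻ x, g x ^ (3 : ℝ) ∂μ) ^ (1 / (3 : ℝ)) :=
        ENNReal.lintegral_mul_le_Lp_mul_Lq μ hpq hfm hgm
    _ ≤ (∫⁻ x, ENNReal.ofReal (b x * w x) ∂μ) ^ (2 / 3 : ℝ) *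
          (∫⁻ x, ENNReal.ofReal (w x) * D x ^ 3 ∂μ) ^ (1 / 3 : ℝ) := by
        rw [show (1 / (3 / 2 : ℝ)) = 2 / 3 by norm_num]
        exact mul_le_mul' (ENNReal.rpow_le_rpow (lintegral_mono fun x => hf2 x) (by norm_num))
          (ENNReal.rpow_le_rpow (lintegral_mono fun x => (hg3 x).le) (by norm_num))

/-- `∫_{cell^N} (|β|²/L³)·W dX = L³ · n_{−n}(|Φ|)/N ≤ L³ K/(‖n‖² p₁)` (`β = L³ ĉ_{−n}(ψ(·|X̂))`,
`lintegral_fibreW_mul_norm_sq_cellFourierCoeff`, and the occupation input at `p = −n`).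
[folklore] -/
private theorem bh_lintegral_beta_weight_le (hL : 0 < L) (n : Fin 3 → ℤ)
    (Φ : PeriodicTrialState (m + 1) L) (hΦ : ∀ X, Φ.ψ X ≠ 0) {K p₁ : ℝ}
    (hocc : cellOccupation (m + 1) L (planeWaveMode L (-n)) (fun X => (‖Φ.ψ X‖ : ℂ)) ≤
      ENNReal.ofReal (K * (m + 1 : ℕ) / (‖(fun j => (n j : ℝ))‖ ^ 2 * p₁))) :
    ∫⁻ X in cellN (m + 1) L, ENNReal.ofReal ((L ^ 3)⁻¹ * ‖fibreBeta n Φ X‖ ^ 2 * fibreW Φ X) ≤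
      ENNReal.ofReal (L ^ 3 * (K / (‖(fun j => (n j : ℝ))‖ ^ 2 * p₁))) := by
  have hL3 : 0 < L ^ 3 := by positivity
  -- the identity `∫ (|β|²/L³)·W = L³ · n_{−n}(|Φ|)/N`
  have hid : ∫⁻ X in cellN (m + 1) L,
      ENNReal.ofReal ((L ^ 3)⁻¹ * ‖fibreBeta n Φ X‖ ^ 2 * fibreW Φ X) =
        ENNReal.ofReal (L ^ 3) *
          (cellOccupation (m + 1) L (planeWaveMode L (-n)) (fun X => (‖Φ.ψ X‖ : ℂ)) /
            (m + 1 : ℝ≥0∞)) := by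
    rw [← lintegral_fibreW_mul_norm_sq_cellFourierCoeff hL Φ hΦ (-n),
      ← lintegral_const_mul' _ _ ENNReal.ofReal_ne_top]
    refine setLIntegral_congr_fun (measurableSet_cellN (m + 1) L) fun X _ => ?_
    rw [← ENNReal.ofReal_mul hL3.le]
    congr 1
    rw [fibreBeta_eq_cellFourierCoeff hL, norm_mul, Complex.norm_real, Real.norm_of_nonneg hL3.le,
      mul_pow]
    field_simp
  rw [hid, ENNReal.ofReal_mul hL3.le]
  refine mul_le_mul' le_rfl (ENNReal.div_le_of_le_mul (hocc.trans_eq ?_))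
  rw [mul_comm K, mul_div_assoc, ENNReal.ofReal_mul (by positivity), ENNReal.ofReal_natCast,
    mul_comm, Nat.cast_succ]

/-! ### The real-number bookkeeping -/

/-- From `K² K_d ‖n‖² ≤ C³ p₁²` to `L⁻³ (L³K/(‖n‖²p₁))^{2/3} (K_d L⁹)^{1/3} ≤ C L²/‖n‖²`
(compare cubes: the left-hand side cubed is `K²K_d L⁶/(‖n‖⁴p₁²)`). [folklore] -/
private theorem bh_real_bound {L N p₁ K Kd C : ℝ} (hL : 0 < L) (hN : 0 < N) (hp : 0 < p₁)
    (hK : 0 ≤ K) (hKd : 0 ≤ Kd) (hC : 0 ≤ C) (key : K ^ 2 * Kd * N ^ 2 ≤ C ^ 3 * p₁ ^ 2) :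
    (L ^ 3)⁻¹ * ((L ^ 3 * (K / (N ^ 2 * p₁))) ^ (2 / 3 : ℝ) * (Kd * L ^ 9) ^ (1 / 3 : ℝ)) ≤
      C * L ^ 2 / N ^ 2 := by
  have hL3 : 0 < L ^ 3 := by positivity
  set A : ℝ := L ^ 3 * (K / (N ^ 2 * p₁)) with hA
  set B : ℝ := Kd * L ^ 9 with hB
  have hA0 : 0 ≤ A := by positivity
  have hB0 : 0 ≤ B := by positivity
  refine le_of_pow_le_pow_left₀ (by norm_num : (3 : ℕ) ≠ 0) (by positivity) ?_
  have h3 : ((L ^ 3)⁻¹ * (A ^ (2 / 3 : ℝ) * B ^ (1 / 3 : ℝ))) ^ 3 =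
      ((L ^ 3)⁻¹) ^ 3 * (A ^ 2 * B) := by
    rw [mul_pow, mul_pow, ← Real.rpow_mul_natCast hA0, ← Real.rpow_mul_natCast hB0,
      show (2 / 3 : ℝ) * ((3 : ℕ) : ℝ) = (2 : ℕ) by norm_num,
      show (1 / 3 : ℝ) * ((3 : ℕ) : ℝ) = 1 by norm_num, Real.rpow_natCast, Real.rpow_one]
  have h1 : ((L ^ 3)⁻¹) ^ 3 * (A ^ 2 * B) = (K ^ 2 * Kd * N ^ 2) * (L ^ 6 / (N ^ 6 * p₁ ^ 2)) := by
    rw [hA, hB]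
    field_simp
  have h2 : (C * L ^ 2 / N ^ 2) ^ 3 = (C ^ 3 * p₁ ^ 2) * (L ^ 6 / (N ^ 6 * p₁ ^ 2)) := by
    field_simp
  rw [h3, h1, h2]
  exact mul_le_mul_of_nonneg_right key (by positivity)

/-- **The window arithmetic**: with `p₁ = min(θ√ρ L/2π, ‖n‖/2)` and `‖n‖ ≤ M√ρ L/2π` one has
`K²K_d‖n‖² ≤ (4K²K_d + K²K_dM²/θ² + 1)·p₁²` in both cases of the `min` — no threshold on `L`.
[folklore] -/
private theorem bh_key {M θ K Kd L N ρ : ℝ} (hM : 0 ≤ M) (hθ : 0 < θ) (hKd : 0 ≤ Kd)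
    (hL : 0 < L) (hN : 0 ≤ N) (hwin : N ≤ M * Real.sqrt ρ * L / (2 * Real.pi)) :
    K ^ 2 * Kd * N ^ 2 ≤
      (4 * K ^ 2 * Kd + K ^ 2 * Kd * M ^ 2 / θ ^ 2 + 1) *
        min (θ * Real.sqrt ρ * L / (2 * Real.pi)) (N / 2) ^ 2 := by
  have hπ := Real.pi_pos
  have hKK : 0 ≤ K ^ 2 * Kd := by positivity
  have hKM : 0 ≤ K ^ 2 * Kd * M ^ 2 / θ ^ 2 := by positivity
  rcases le_total (θ * Real.sqrt ρ * L / (2 * Real.pi)) (N / 2) with h | h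
  · rw [min_eq_left h]
    have h0 : 0 ≤ M * Real.sqrt ρ * L / (2 * Real.pi) := by positivity
    have hsq : N ^ 2 ≤ M ^ 2 / θ ^ 2 * (θ * Real.sqrt ρ * L / (2 * Real.pi)) ^ 2 := by
      calc N ^ 2 ≤ (M * Real.sqrt ρ * L / (2 * Real.pi)) ^ 2 := pow_le_pow_left₀ hN hwin 2
        _ = M ^ 2 / θ ^ 2 * (θ * Real.sqrt ρ * L / (2 * Real.pi)) ^ 2 := by
            field_simp
    calc K ^ 2 * Kd * N ^ 2
        ≤ K ^ 2 * Kd * (M ^ 2 / θ ^ 2 * (θ * Real.sqrt ρ * L / (2 * Real.pi)) ^ 2) := by gcongr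
      _ = (K ^ 2 * Kd * M ^ 2 / θ ^ 2) * (θ * Real.sqrt ρ * L / (2 * Real.pi)) ^ 2 := by ring
      _ ≤ (4 * K ^ 2 * Kd + K ^ 2 * Kd * M ^ 2 / θ ^ 2 + 1) *
            (θ * Real.sqrt ρ * L / (2 * Real.pi)) ^ 2 :=
          mul_le_mul_of_nonneg_right (by linarith) (sq_nonneg _)
  · rw [min_eq_right h]
    calc K ^ 2 * Kd * N ^ 2 = (4 * K ^ 2 * Kd) * (N / 2) ^ 2 := by ring
      _ ≤ (4 * K ^ 2 * Kd + K ^ 2 * Kd * M ^ 2 / θ ^ 2 + 1) * (N / 2) ^ 2 :=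
          mul_le_mul_of_nonneg_right (by linarith) (sq_nonneg _)

/-! ### The β-corrector at one datum -/

/-- **The Hölder β-corrector at one datum**: given the density-flattening flow `J` (weak divergence
`ψ² − L⁻³`, `∫ W·D³ ≤ K_d L⁹`), the occupation bound at the resonant mode `−n` with radius `p₁`,
and the scalar inequality `K² K_d ‖n‖² ≤ C³ p₁²`, the flow `J♮ = L^{-3/2} β J` is measurable, has
weak divergence `ε♮ = densDefect` and cost `≤ C L²/‖n‖²`. [folklore] -/
theorem bh_betaHolder_datum (hL : 0 < L) {n : Fin 3 → ℤ} (hn : n ≠ 0)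
    (Φ : PeriodicTrialState (m + 1) L) (hΦ : ∀ X, Φ.ψ X ≠ 0) {J : Config (m + 1) → Fin 3 → ℂ}
    (hJm : Measurable J)
    (hJd : HasWeakDiv L J (fun X => ((fibrePsi Φ X ^ 2 - (L ^ 3)⁻¹ : ℝ) : ℂ)))
    {Kd : ℝ} (hKd : 0 ≤ Kd) (hJc : ∫⁻ X in cellN (m + 1) L,
      ENNReal.ofReal (fibreW Φ X) * fibreDensCost Φ J X ^ 3 ≤ ENNReal.ofReal (Kd * L ^ 9))
    {K p₁ : ℝ} (hK : 0 ≤ K) (hp₁ : 0 < p₁)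
    (hocc : cellOccupation (m + 1) L (planeWaveMode L (-n)) (fun X => (‖Φ.ψ X‖ : ℂ)) ≤
      ENNReal.ofReal (K * (m + 1 : ℕ) / (‖(fun j => (n j : ℝ))‖ ^ 2 * p₁)))
    {C : ℝ} (hC : 0 ≤ C) (key : K ^ 2 * Kd * ‖(fun j => (n j : ℝ))‖ ^ 2 ≤ C ^ 3 * p₁ ^ 2) :
    ∃ J' : Config (m + 1) → (Fin 3 → ℂ), Measurable J' ∧ HasWeakDiv L J' (densDefect n Φ) ∧
      fibreCost Φ J' ≤ ENNReal.ofReal (C * L ^ 2 / ‖(fun j => (n j : ℝ))‖ ^ 2) := by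
  have hL3 : 0 < L ^ 3 := by positivity
  have hN : 0 < ‖(fun j => (n j : ℝ))‖ := lt_of_lt_of_le one_pos (one_le_norm_intVec hn)
  have hβm := measurable_fibreBeta hL n Φ hΦ
  refine ⟨fun X l => ((Real.sqrt (L ^ 3))⁻¹ : ℂ) * fibreBeta n Φ X * J X l, ?_, ?_, ?_⟩
  · exact measurable_pi_lambda _ fun l =>
      (measurable_const.mul hβm).mul ((measurable_pi_apply l).comp hJm)
  · exact bc_hasWeakDiv_beta_mul hL n Φ hΦ ((Real.sqrt (L ^ 3))⁻¹ : ℂ) hJd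
  · -- the cost: bath average, Hölder in the bath, occupation input, arithmetic
    have hKd9 : 0 ≤ Kd * L ^ 9 := by positivity
    have hb0 : ∀ X : Config (m + 1), 0 ≤ (L ^ 3)⁻¹ * ‖fibreBeta n Φ X‖ ^ 2 :=
      fun X => by positivity
    have hb1 : ∀ X : Config (m + 1), (L ^ 3)⁻¹ * ‖fibreBeta n Φ X‖ ^ 2 ≤ 1 := fun X => by
      rw [inv_mul_le_iff₀ hL3, mul_one]
      exact norm_sq_fibreBeta_le hL n Φ hΦ X
    have hH := bh_lintegral_mul_le (volume.restrict (cellN (m + 1) L))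
      (b := fun X => (L ^ 3)⁻¹ * ‖fibreBeta n Φ X‖ ^ 2) (w := fibreW Φ) (D := fibreDensCost Φ J)
      (measurable_const.mul (hβm.norm.pow_const 2)) (measurable_fibreW Φ)
      (bh_measurable_fibreDensCost hL Φ hΦ hJm) hb0 hb1
    have hwt := bh_lintegral_beta_weight_le hL n Φ hΦ hocc
    rw [bh_fibreCost_eq hL n Φ hΦ hJm]
    -- `cost ≤ L⁻³ (L³K/(‖n‖²p₁))^{2/3} (K_d L⁹)^{1/3} = ofReal (…) ≤ ofReal (C L²/‖n‖²)`
    refine (mul_le_mul' le_rfl (hH.trans (mul_le_mul' (ENNReal.rpow_le_rpow hwt (by norm_num))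
      (ENNReal.rpow_le_rpow hJc (by norm_num))))).trans ?_
    rw [ENNReal.ofReal_rpow_of_nonneg (by positivity) (by norm_num),
      ENNReal.ofReal_rpow_of_nonneg hKd9 (by norm_num),
      ← ENNReal.ofReal_mul (Real.rpow_nonneg (by positivity) _),
      ← ENNReal.ofReal_inv_of_pos hL3, ← ENNReal.ofReal_mul (inv_nonneg.2 hL3.le)]
    exact ENNReal.ofReal_le_ofReal (bh_real_bound hL hN hp₁ hK hKd hC key)

/-! ### The registered stub -/

/-- **Registered stub `stub_betaHolder` — the β-CHANNEL BY HÖLDER**: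
`DensityFlatteningCubic → ShellOccupation → BetaCorrectorBound`, with `ρ₀ = min ρ_d ρ_s`,
`N₀ = max N_d N_s`, the admissible shell radius `p₁ = min(θ√ρ L/2π, ‖n‖/2)` at the resonant mode
`p = −n`, and the constant `C = 4K²K_d + K²K_dM²/θ² + 1` (`C ≥ 1`, so `C³ ≥ C` dominates the window
arithmetic `bh_key`); no threshold on `L`. [folklore] -/
theorem stub_betaHolder : Goal.stub_betaHolder := by
  intro hD hS v hv hbdd M hM
  obtain ⟨ρd, Kd, hρd, hKd, Nd, hd⟩ := hD v hv hbdd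
  obtain ⟨θ, ρs, K, hθ, hρs, hK, Ns, hs⟩ := hS v hv hbdd M hM
  -- thresholds and the constant
  set ρ₀ : ℝ := min ρd ρs
  have hρ₀pos : 0 < ρ₀ := lt_min hρd hρs
  set C : ℝ := 4 * K ^ 2 * Kd + K ^ 2 * Kd * M ^ 2 / θ ^ 2 + 1
  have hC1 : 1 ≤ C := by
    have : 0 ≤ 4 * K ^ 2 * Kd + K ^ 2 * Kd * M ^ 2 / θ ^ 2 := by positivity
    linarith
  refine ⟨ρ₀, C, hρ₀pos, lt_of_lt_of_le one_pos hC1, max Nd Ns, ?_⟩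
  intro m hm L hL hρ n hn hw Φ hE hz
  have hmd : Nd ≤ m + 1 := le_trans (le_max_left _ _) hm
  have hms : Ns ≤ m + 1 := le_trans (le_max_right _ _) hm
  have hL3 : (0 : ℝ) < L ^ 3 := by positivity
  have hρa : ((m + 1 : ℕ) : ℝ) ≤ ρd * L ^ 3 :=
    hρ.trans (mul_le_mul_of_nonneg_right (min_le_left _ _) hL3.le)
  have hρb : ((m + 1 : ℕ) : ℝ) ≤ ρs * L ^ 3 :=
    hρ.trans (mul_le_mul_of_nonneg_right (min_le_right _ _) hL3.le)
  obtain ⟨J, hJm, hJd, hJc⟩ := hd m hmd L hL hρa Φ hE hz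
  have hS' := hs m hms L hL hρb n hn hw Φ hE hz
  -- the density and the window
  set N : ℝ := ‖(fun j => (n j : ℝ))‖
  have hN1 : 1 ≤ N := one_le_norm_intVec hn
  set ρ : ℝ := ((m + 1 : ℕ) : ℝ) / L ^ 3 with hρdef
  have hρpos : 0 < ρ := hρdef ▸ div_pos (Nat.cast_pos.2 m.succ_pos) hL3
  have hwin : N ≤ M * Real.sqrt ρ * L / (2 * Real.pi) := by
    rw [le_div_iff₀ (by positivity)]
    have := (div_le_iff₀ hL).1 hw
    linarith
  -- the admissible shell radius and the resonant mode `p = -n`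
  set p₁ : ℝ := min (θ * Real.sqrt ρ * L / (2 * Real.pi)) (N / 2)
  have hp₁ : 0 < p₁ := lt_min (by positivity) (by linarith)
  have hshell : ‖(fun j => (((-n) j + n j : ℤ) : ℝ))‖ < p₁ := by
    rwa [show (fun j => (((-n) j + n j : ℤ) : ℝ)) = 0 from funext fun j => by simp, norm_zero]
  have hocc := hS' p₁ hp₁ (min_le_left _ _) (min_le_right _ _) (-n) hshell
  have key : K ^ 2 * Kd * N ^ 2 ≤ C ^ 3 * p₁ ^ 2 :=
    (bh_key hM.le hθ hKd.le hL (by linarith) hwin).trans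
      (mul_le_mul_of_nonneg_right (le_self_pow₀ hC1 three_ne_zero) (sq_nonneg _))
  exact bh_betaHolder_datum hL hn Φ hz hJm hJd hKd.le hJc hK.le hp₁ hocc (by linarith) key

end Summit.AtomisticToContinuum.BoseEinsteinCondensation.Cruxes.FibreConductance.TaggedPathHarnack

end
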